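import Literature.Probability.RandomPlanarGeometry.LoopDistanceParametrisation
import HarnessLib

/-!
# Arcs of close loops: a parameter arc of one loop is shadowed by a sub-continuum of the other

Topic `Literature/Probability/RandomPlanarGeometry`; proofs only.  When two loops are close in
DKKMO's unoriented loop distance `d` (`UnbasedLoop.udist`, arXiv:2012.11672v2 eq. (1)), every
parameter arc `α([s, t])` of a based representative `α` of the first loop is shadowed by a compact
connected piece `H` of the TRACE of the second loop: every point of the arc is within `ε` of `H`
and every point of `H` is within `ε` of the arc (indeed the two are matched time by time by a
common parametrisation, `Curve.exists_orientation_shift_reparam_forall_dist_lt`: a time reversal,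
a change of base point and an increasing reparametrisation of the second loop).  This is the form
in which closeness of loop configurations (`LoopConfig.IsClose`) transfers "a loop arc crosses a
plate" from one percolation model to a continuum crossing by the loops of the other
(Camia–Newman, CMP 268 (2006), §5; DKKMO §5.2):

* `Curve.exists_continuum_near_arc_of_udist_lt` — for based representatives `α`, `β`;
* `CurveClass.exists_continuum_near_arc_of_udist_lt` — for loop classes `c`, `c'` and any based
  representative `α` of `c` (the piece lies in `c'.range`).

## References

* H. Duminil-Copin, K. K. Kozlowski, D. Krachun, I. Manolescu, M. Oulamara, arXiv:2012.11672v2,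
  §1.2 eq. (1), §5.2 [arXiv201211672v2].
* F. Camia, C. M. Newman, Comm. Math. Phys. 268 (2006), §5 [CamiaNewman2006].
-/

noncomputable section

namespace Literature.Probability.RandomPlanarGeometry

open Set Metric unitInterval

variable {E : Type*} [MetricSpace E]

/-- **A parameter arc of a loop is shadowed by a sub-continuum of any `ε`-close loop.**  If the
unbased loops of the based loops `α`, `β` are at unoriented distance `d < ε`, then for every
parameter interval `[s, t]` there is a compact connected `H ⊆ range β` such that every `α u`,
`u ∈ [s, t]`, is within `ε` of a point of `H`, and every point of `H` is within `ε` of some `α u`,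
`u ∈ [s, t]` (`H` is the image of `[s, t]` under the `ε`-close parametrisation of `β` given by
`Curve.exists_orientation_shift_reparam_forall_dist_lt`). [cite: arXiv201211672v2, §1.2 eq. (1)] -/
theorem Curve.exists_continuum_near_arc_of_udist_lt {α β : Curve E} (hα : α.IsLoop)
    (hβ : β.IsLoop) {ε : ℝ}
    (h : UnbasedLoop.udist (UnbasedLoop.mk (BasedLoop.mk (CurveClass.mk α) (CurveClass.isLoop_mk.2 hα)))
      (UnbasedLoop.mk (BasedLoop.mk (CurveClass.mk β) (CurveClass.isLoop_mk.2 hβ))) < ε) (s t : I) :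
    ∃ H ⊆ β.range, IsCompact H ∧ IsPreconnected H ∧
      (∀ u ∈ Icc s t, ∃ p ∈ H, dist (α u) p < ε) ∧ (∀ p ∈ H, ∃ u ∈ Icc s t, dist (α u) p < ε) := by
  obtain ⟨β', hβ', -, b, φ, hclose⟩ := Curve.exists_orientation_shift_reparam_forall_dist_lt hα hβ h
  refine ⟨((β'.shift b).reparam φ) '' Icc s t, ?_, isCompact_Icc.image (Curve.continuous _),
    isPreconnected_Icc.image _ (Curve.continuous _).continuousOn, ?_, ?_⟩
  · have hr : ((β'.shift b).reparam φ).range = β.range := by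
      rw [Curve.range_reparam, Curve.range_shift]
      rcases hβ' with rfl | rfl
      · rfl
      · exact Curve.range_reverse β
    rw [← hr]
    rintro _ ⟨u, -, rfl⟩
    exact ⟨u, rfl⟩
  · exact fun u hu ↦ ⟨_, mem_image_of_mem _ hu, hclose u⟩
  · rintro _ ⟨u, hu, rfl⟩
    exact ⟨u, hu, hclose u⟩

/-- **A parameter arc of a loop class is shadowed by a sub-continuum of the trace of any
`ε`-close loop class**: the same for loop classes `c`, `c'` at unoriented unbased distance `< ε`
and an arbitrary based representative `α` of `c` (`CurveClass.mk α = c`); the piece lies in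
`c'.range`. [cite: arXiv201211672v2, §1.2 eq. (1)] -/
theorem CurveClass.exists_continuum_near_arc_of_udist_lt {c c' : CurveClass E} (hc : c.IsLoop)
    (hc' : c'.IsLoop) {ε : ℝ}
    (h : UnbasedLoop.udist (UnbasedLoop.mk (BasedLoop.mk c hc)) (UnbasedLoop.mk (BasedLoop.mk c' hc')) < ε)
    {α : Curve E} (hα : CurveClass.mk α = c) (s t : I) :
    ∃ H ⊆ c'.range, IsCompact H ∧ IsPreconnected H ∧
      (∀ u ∈ Icc s t, ∃ p ∈ H, dist (α u) p < ε) ∧ (∀ p ∈ H, ∃ u ∈ Icc s t, dist (α u) p < ε) := by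
  subst hα
  obtain ⟨β, rfl⟩ := CurveClass.surjective_mk c'
  rw [CurveClass.range_mk]
  exact Curve.exists_continuum_near_arc_of_udist_lt (CurveClass.isLoop_mk.1 hc) (CurveClass.isLoop_mk.1 hc') h s t

end Literature.Probability.RandomPlanarGeometry
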